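import Summits.CriticalPhenomena.CardyFormulaZ2.Theorems.CardySusyWardDiscretisationFamilyExistsLattice
import HarnessLib

/-!
# No forced site away from the cut: helper for `DiscretisationFamilyExists` (stmt-CriticalPhenomena-9644)

The marker-free reduction `zdDiscretisationFamily_of_labelling`
(`CardySelfRefinementLagHandOffDiscretisableLabelling.lean`) asks, for a labelling
`zdBoundary = S_A ⊔ S_B` of the square-lattice boundary of the canonical discrete domain, for the
**no-forcing condition**: no disc `B y = closedBall (δy) (infDist (δy) ∂Ω)` of an `A`-site `y` is
covered by the discs of the `B`-sites (and vice versa) — by the forcing lemma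
(`…DiscretisableForcing.lean`) this is necessary for any marker realisation.  This file proves
that the condition is AUTOMATIC away from the two cut edges:

* `not_closedBall_subset_of_forall_not_adj` (**covering lemma**): if `y` is a boundary site and
  `X` a finite set of boundary sites none of which is `Ω_δ`-adjacent to `y` (`y ∉ X`), then
  `B y ⊄ ⋃ x ∈ X, B x`.  Proof (`add_diag_mem_of_cover`): looking at the points `δy + s d` for the
  four diagonal directions `d` and `s ↓ 0`, a covering disc must belong to the diagonal neighbour
  `y + d` and have the maximal radius `δ√2` (an adjacent covering site would be joined to `y` by an
  edge of `Ω_δ`, its disc containing the segment); the four empty open discs of radius `δ√2` about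
  the diagonal neighbours then make the four faces at `y` inner and its four edges edges of `Ω_δ`,
  so `y` is not a boundary site.
* On the way: `exists_frontier_le_sqrt_two` (every boundary site is within `δ√2` of `∂Ω`, the
  sharp form of `exists_frontier_near_of_mem_zdBoundary₀` of `BoundaryValues.lean`).

In a labelling whose bichromatic `Ω_δ`-edges are exactly the two cut edges, an `A`-site off the
cut edges has no `Ω_δ`-adjacent `B`-site, so the covering lemma discharges the no-forcing
hypotheses of the reduction at every site except the four endpoints of the cuts.
-/

noncomputable section

open Set Metric Filter Topology
open Literature.Probability.LatticeModels Literature.Probability.Percolation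

namespace Summit.CriticalPhenomena.CardyFormulaZ2.Theorems.DiscretisationFamilyExists

/-! ### Boundary sites are within `δ√2` of the frontier -/

/-- **Every site of the square-lattice boundary `zdBoundary` of an open set is within `δ√2` of a
frontier point** (sharp form of `exists_frontier_near_of_mem_zdBoundary₀`): a vertex-boundary
site has a unit mesh segment meeting `∂Ω`; an endpoint of a face-boundary edge corners a non-inner
face, whose closed cell (of diameter `δ√2`) contains a point off `Ω` by the exit-witness lemma.
[folklore] -/
theorem exists_frontier_le_sqrt_two {E : DiscreteDobrushin} (hΩ : IsOpen E.Ω) (hδ : 0 < E.δ)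
    {x : Site 2} (hx : x ∈ E.zdBoundary) :
    ∃ z ∈ frontier E.Ω, dist (meshPoint E.δ x) z ≤ Real.sqrt 2 * E.δ := by
  have h12 : E.δ ≤ Real.sqrt 2 * E.δ := by
    have : (1 : ℝ) ≤ Real.sqrt 2 := Real.one_le_sqrt.2 (by norm_num)
    nlinarith
  rcases E.mem_zdBoundary_iff.1 hx with hxb | ⟨w, hadj, -, g, hg, hxg, -⟩
  · obtain ⟨y, hxy, z, hz, hzf⟩ := exists_mem_frontier_of_mem_meshBoundary hΩ hxb
    have h1 : dist z (meshPoint E.δ x) ≤ E.δ :=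
      dist_le_of_mem_segment hz (by rw [dist_self]; exact hδ.le)
        (by rw [dist_comm, dist_meshPoint_of_adj hxy, abs_of_pos hδ])
    refine ⟨z, hzf, ?_⟩
    rw [dist_comm]
    exact h1.trans h12
  · have hxD : x ∈ meshDomain E.Ω E.δ := (discreteDomainGraph_adj_iff.1 hadj).2.1
    have hxΩ : meshPoint E.δ x ∈ E.Ω := meshDomain_subset_meshVertices _ _ hxD
    -- a point of the closed cell of `g` off `Ω`, within `δ√2` of `δx`
    obtain ⟨q, hqΩ, hqd⟩ : ∃ q, q ∉ E.Ω ∧ dist q (meshPoint E.δ x) ≤ Real.sqrt 2 * E.δ := by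
      rcases DiscreteDobrushin.exists_witness_of_not_isInnerFace hg hxg hxD with
        ⟨v, w', hv, hw', -, hseg⟩ | ⟨u, hu, huV⟩
      · obtain ⟨q, hq, hqc⟩ := not_subset.1 hseg
        exact ⟨q, fun h => hqc (subset_closure h), dist_le_of_mem_segment hq
          (dist_corner_corner_le hδ.le hv hxg) (dist_corner_corner_le hδ.le hw' hxg)⟩
      · exact ⟨meshPoint E.δ u, huV, dist_corner_corner_le hδ.le hu hxg⟩
    obtain ⟨z, hz, hzf⟩ := exists_mem_segment_frontier hΩ hxΩ
      (fun h => hqΩ (h (right_mem_segment ℝ _ q)))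
    refine ⟨z, hzf, ?_⟩
    rw [dist_comm]
    exact dist_le_of_mem_segment hz (by rw [dist_self]; positivity) hqd

/-- Boundary sites are at `infDist ≤ δ√2` from the frontier. [folklore] -/
theorem infDist_frontier_le_sqrt_two {E : DiscreteDobrushin} (hΩ : IsOpen E.Ω) (hδ : 0 < E.δ)
    {x : Site 2} (hx : x ∈ E.zdBoundary) :
    infDist (meshPoint E.δ x) (frontier E.Ω) ≤ Real.sqrt 2 * E.δ := by
  obtain ⟨z, hzf, hz⟩ := exists_frontier_le_sqrt_two hΩ hδ hx
  exact (infDist_le_dist_of_mem hzf).trans hz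

/-- The distance from the mesh point of a boundary site of an open set to the frontier is positive.
[folklore] -/
theorem infDist_frontier_pos {E : DiscreteDobrushin} (hΩ : IsOpen E.Ω) (hδ : 0 < E.δ)
    {x : Site 2} (hx : x ∈ E.zdBoundary) : 0 < infDist (meshPoint E.δ x) (frontier E.Ω) := by
  obtain ⟨z, hzf, -⟩ := exists_frontier_le_sqrt_two hΩ hδ hx
  have hxΩ : meshPoint E.δ x ∈ E.Ω := meshDomain_subset_meshVertices _ _ (E.zdBoundary_subset_meshDomain hx)
  rw [← isClosed_frontier.notMem_iff_infDist_pos ⟨z, hzf⟩]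
  exact fun h => (hΩ.inter_frontier_eq ▸ ⟨hxΩ, h⟩ : meshPoint E.δ x ∈ (∅ : Set ℂ))

/-! ### The covering lemma -/

/-- **Directional forcing.** Let the disc `B y = closedBall (δy) (infDist (δy) ∂Ω)` of the
boundary site `y` be covered by the discs of the finite set `X ∌ y` of boundary sites, and fix one
of the four diagonal directions `k`; assume that no site of `X` joined to `y` by an edge of `Ω_δ`
has the points `δy + s·δ((cornerUnit k + cornerUnit (k + 1)))`, `0 < s ≤ 1`, in its disc (vacuous if no site of `X` is
`Ω_δ`-adjacent to `y`).  Then the diagonal neighbour `y + (cornerUnit k + cornerUnit (k + 1))` belongs to `X` and the open disc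
of radius `δ√2` about its mesh point lies in `Ω`.  (Cover the points `δy + s·δ((cornerUnit k + cornerUnit (k + 1)))`, `s ↓ 0`: a
covering disc of a site of `X` at distance `> infDist` from `δy` eventually fails, so some
covering site `x` has `δy` in its disc; it is not a lattice neighbour — its disc would contain the
segment `[δy, δx]`, making it `Ω_δ`-adjacent, which is excluded — so it is a diagonal neighbour
with the maximal radius `δ√2`, and the direction singles out `(cornerUnit k + cornerUnit (k + 1))`.) [folklore] -/
theorem add_diag_mem_of_cover {E : DiscreteDobrushin} (hΩ : IsOpen E.Ω) (hδ : 0 < E.δ)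
    {y : Site 2} (hy : y ∈ E.zdBoundary) {X : Set (Site 2)} (hX : X ⊆ E.zdBoundary)
    (hfin : X.Finite) (hyX : y ∉ X)
    (hcov : closedBall (meshPoint E.δ y) (infDist (meshPoint E.δ y) (frontier E.Ω)) ⊆
      ⋃ x ∈ X, closedBall (meshPoint E.δ x) (infDist (meshPoint E.δ x) (frontier E.Ω)))
    (k : Fin 4)
    (hadj : ∀ x ∈ X, (discreteDomainGraph E.Ω E.δ).Adj y x → ∀ s : ℝ, 0 < s → s ≤ 1 →
      infDist (meshPoint E.δ x) (frontier E.Ω) <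
        dist (meshPoint E.δ x) (meshPoint E.δ y + s • meshPoint E.δ ((cornerUnit k + cornerUnit (k + 1))))) :
    y + (cornerUnit k + cornerUnit (k + 1)) ∈ X ∧ ball (meshPoint E.δ (y + (cornerUnit k + cornerUnit (k + 1)))) (Real.sqrt 2 * E.δ) ⊆ E.Ω := by
  set δ := E.δ with hδdef
  set ρ : Site 2 → ℝ := fun z => infDist (meshPoint δ z) (frontier E.Ω) with hρ
  have hyD : y ∈ meshDomain E.Ω δ := E.zdBoundary_subset_meshDomain hy
  have hyΩ : meshPoint δ y ∈ E.Ω := meshDomain_subset_meshVertices _ _ hyD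
  have hρy : 0 < ρ y := infDist_frontier_pos hΩ hδ hy
  set Dk : ℂ := meshPoint δ ((cornerUnit k + cornerUnit (k + 1))) with hDk
  have hDk_norm : ‖Dk‖ = Real.sqrt 2 * δ := norm_meshPoint_diag hδ.le k
  have hsqδ : 0 < Real.sqrt 2 * δ := by positivity
  -- the far sites of `X` stop covering the points `δy + s Dk` for small `s`
  set X'' : Set (Site 2) := {x ∈ X | ρ x < dist (meshPoint δ x) (meshPoint δ y)} with hX''
  have hfin'' : X''.Finite := hfin.subset (sep_subset _ _)
  have h1 : ∀ᶠ s : ℝ in 𝓝 0, ∀ x ∈ X'', ρ x < dist (meshPoint δ x) (meshPoint δ y + s • Dk) := by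
    rw [eventually_all_finite hfin'']
    intro x hx
    have hcont : Tendsto (fun s : ℝ => dist (meshPoint δ x) (meshPoint δ y + s • Dk)) (𝓝 0)
        (𝓝 (dist (meshPoint δ x) (meshPoint δ y + (0:ℝ) • Dk))) :=
      ((continuous_const.dist (continuous_const.add (continuous_id.smul continuous_const))).tendsto 0)
    rw [zero_smul, add_zero] at hcont
    exact hcont.eventually_const_lt hx.2
  have h2 : ∀ᶠ s : ℝ in 𝓝[>] 0, 0 < s ∧ s ≤ 1 ∧ s * (Real.sqrt 2 * δ) ≤ ρ y := by
    have hb : 0 < min 1 (ρ y / (Real.sqrt 2 * δ)) := lt_min one_pos (div_pos hρy hsqδ)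
    filter_upwards [Ioo_mem_nhdsGT hb] with s hs
    refine ⟨hs.1, hs.2.le.trans (min_le_left _ _), ?_⟩
    have := hs.2.le.trans (min_le_right _ _)
    rwa [le_div_iff₀ hsqδ] at this
  obtain ⟨s, hs1, hs0, hs1', hsρ⟩ := ((h1.filter_mono nhdsWithin_le_nhds).and h2).exists
  -- the point `δy + s Dk` is covered by some `x ∈ X` with `δy` in its disc
  set pt : ℂ := meshPoint δ y + s • Dk with hpt
  have hptB : pt ∈ closedBall (meshPoint δ y) (ρ y) := by
    rw [mem_closedBall, hpt, dist_eq_norm, add_sub_cancel_left, norm_smul, Real.norm_of_nonneg hs0.le,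
      hDk_norm]
    exact hsρ
  obtain ⟨x, hxX, hxpt⟩ : ∃ x ∈ X, pt ∈ closedBall (meshPoint δ x) (ρ x) := by
    simpa only [mem_iUnion, exists_prop] using hcov hptB
  rw [mem_closedBall] at hxpt
  have hxy : dist (meshPoint δ x) (meshPoint δ y) ≤ ρ x := by
    by_contra hlt
    push Not at hlt
    have := hs1 x ⟨hxX, hlt⟩
    rw [dist_comm] at hxpt
    exact absurd hxpt (not_le.2 this)
  have hxb : x ∈ E.zdBoundary := hX hxX
  have hxD : x ∈ meshDomain E.Ω δ := E.zdBoundary_subset_meshDomain hxb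
  have hxΩ : meshPoint δ x ∈ E.Ω := meshDomain_subset_meshVertices _ _ hxD
  have hρx : ρ x ≤ Real.sqrt 2 * δ := infDist_frontier_le_sqrt_two hΩ hδ hxb
  have hxney : x ≠ y := fun h => hyX (h ▸ hxX)
  -- `x` is not `Ω_δ`-adjacent to `y` (it covers `pt`), hence not a lattice neighbour of `y`:
  -- its disc would contain the unit segment
  have hnadjΩ : ¬ (discreteDomainGraph E.Ω δ).Adj y x := fun h => by
    have := hadj x hxX h s hs0 hs1'
    rw [dist_comm] at hxpt
    exact absurd hxpt (not_le.2 this)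
  have hnadj : ¬ (zdGraph 2).Adj y x := by
    intro hzd
    apply hnadjΩ
    have hρx0 : 0 < ρ x := by
      have : dist (meshPoint δ x) (meshPoint δ y) = δ := by
        rw [dist_comm, dist_meshPoint_of_adj hzd, abs_of_pos hδ]
      linarith
    have hseg : segment ℝ (meshPoint δ y) (meshPoint δ x) ⊆ closure E.Ω := by
      refine ((convex_closedBall _ _).segment_subset ?_ (mem_closedBall_self hρx0.le)).trans
        (closedBall_infDist_frontier_subset hΩ hxΩ hρx0)
      rw [mem_closedBall, dist_comm]; exact hxy
    exact discreteDomainGraph_adj_iff.2 ⟨meshGraph_adj_iff.2 ⟨hzd, hseg⟩, hyD, hxD⟩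
  -- so `x` is a diagonal neighbour with the maximal radius
  obtain ⟨j, rfl⟩ := exists_eq_add_diag_of_dist_le hδ hxney hnadj (hxy.trans hρx)
  have hρj : ρ (y + (cornerUnit j + cornerUnit (j + 1))) = Real.sqrt 2 * δ :=
    le_antisymm hρx (by rw [← dist_meshPoint_add_diag hδ.le y j]; exact hxy)
  -- the direction forces `j`'s diagonal to be `(cornerUnit k + cornerUnit (k + 1))`
  have hjk : (cornerUnit j + cornerUnit (j + 1)) = (cornerUnit k + cornerUnit (k + 1)) := by
    have hle : ‖s • Dk - meshPoint δ ((cornerUnit j + cornerUnit (j + 1)))‖ ^ 2 ≤ (Real.sqrt 2 * δ) ^ 2 := by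
      refine pow_le_pow_left₀ (norm_nonneg _) ?_ 2
      have : dist pt (meshPoint δ (y + (cornerUnit j + cornerUnit (j + 1)))) = ‖s • Dk - meshPoint δ ((cornerUnit j + cornerUnit (j + 1)))‖ := by
        rw [hpt, meshPoint_add_diag, dist_eq_norm]; congr 1; ring
      rw [← this]; exact hxpt.trans (hρj.le)
    rw [hDk, norm_smul_meshPoint_sub_sq, mul_pow, Real.sq_sqrt (by norm_num : (0:ℝ) ≤ 2)] at hle
    have hk0 := diag_apply_sq k 0
    have hk1 := diag_apply_sq k 1
    have hj0 := diag_apply_sq j 0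
    have hj1 := diag_apply_sq j 1
    -- `2 s² - 2 s ⟨(cornerUnit k + cornerUnit (k + 1)), (cornerUnit j + cornerUnit (j + 1))⟩ + 2 ≤ 2`, so the inner product is `≥ s > 0`
    have hip : 0 < ((cornerUnit j + cornerUnit (j + 1)) 0 : ℝ) * ((cornerUnit k + cornerUnit (k + 1)) 0 : ℝ) + ((cornerUnit j + cornerUnit (j + 1)) 1 : ℝ) * ((cornerUnit k + cornerUnit (k + 1)) 1 : ℝ) := by
      have hδ2 : 0 < δ ^ 2 := by positivity
      by_contra hle'
      push Not at hle'
      have : δ ^ 2 * ((s * ((cornerUnit k + cornerUnit (k + 1)) 0 : ℝ) - ((cornerUnit j + cornerUnit (j + 1)) 0 : ℝ)) ^ 2 + (s * ((cornerUnit k + cornerUnit (k + 1)) 1 : ℝ) - ((cornerUnit j + cornerUnit (j + 1)) 1 : ℝ)) ^ 2)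
          > 2 * δ ^ 2 := by
        have hexp : (s * ((cornerUnit k + cornerUnit (k + 1)) 0 : ℝ) - ((cornerUnit j + cornerUnit (j + 1)) 0 : ℝ)) ^ 2 + (s * ((cornerUnit k + cornerUnit (k + 1)) 1 : ℝ) - ((cornerUnit j + cornerUnit (j + 1)) 1 : ℝ)) ^ 2
            = 2 * s ^ 2 - 2 * s * (((cornerUnit j + cornerUnit (j + 1)) 0 : ℝ) * ((cornerUnit k + cornerUnit (k + 1)) 0 : ℝ) + ((cornerUnit j + cornerUnit (j + 1)) 1 : ℝ) * ((cornerUnit k + cornerUnit (k + 1)) 1 : ℝ)) + 2 := by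
          linear_combination s ^ 2 * hk0 + s ^ 2 * hk1 + hj0 + hj1
        rw [hexp]
        have hq : 0 < 2 * s ^ 2 - 2 * s * (((cornerUnit j + cornerUnit (j + 1)) 0 : ℝ) * ((cornerUnit k + cornerUnit (k + 1)) 0 : ℝ) + ((cornerUnit j + cornerUnit (j + 1)) 1 : ℝ) * ((cornerUnit k + cornerUnit (k + 1)) 1 : ℝ)) := by
          nlinarith [mul_nonneg hs0.le (neg_nonneg.2 hle'), sq_pos_of_pos hs0]
        nlinarith [mul_pos hδ2 hq]
      linarith
    -- each coordinate product is `±1`; a positive sum forces both to be `1`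
    have hprod : ∀ i : Fin 2, (cornerUnit j + cornerUnit (j + 1)) i * (cornerUnit k + cornerUnit (k + 1)) i = 1 ∨ (cornerUnit j + cornerUnit (j + 1)) i * (cornerUnit k + cornerUnit (k + 1)) i = -1 := by
      intro i
      rcases diag_apply j i with h | h <;> rcases diag_apply k i with h' | h' <;> rw [h, h'] <;> decide
    have h0 : 0 < (cornerUnit j + cornerUnit (j + 1)) 0 * (cornerUnit k + cornerUnit (k + 1)) 0 := by
      rcases hprod 0 with h | h
      · rw [h]; decide
      · exfalso
        rcases hprod 1 with h' | h'
        · have : ((cornerUnit j + cornerUnit (j + 1)) 0 : ℝ) * ((cornerUnit k + cornerUnit (k + 1)) 0 : ℝ) + ((cornerUnit j + cornerUnit (j + 1)) 1 : ℝ) * ((cornerUnit k + cornerUnit (k + 1)) 1 : ℝ) = 0 := by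
            exact_mod_cast (show (cornerUnit j + cornerUnit (j + 1)) 0 * (cornerUnit k + cornerUnit (k + 1)) 0 + (cornerUnit j + cornerUnit (j + 1)) 1 * (cornerUnit k + cornerUnit (k + 1)) 1 = 0 by rw [h, h']; decide)
          linarith
        · have : ((cornerUnit j + cornerUnit (j + 1)) 0 : ℝ) * ((cornerUnit k + cornerUnit (k + 1)) 0 : ℝ) + ((cornerUnit j + cornerUnit (j + 1)) 1 : ℝ) * ((cornerUnit k + cornerUnit (k + 1)) 1 : ℝ) = -2 := by
            exact_mod_cast (show (cornerUnit j + cornerUnit (j + 1)) 0 * (cornerUnit k + cornerUnit (k + 1)) 0 + (cornerUnit j + cornerUnit (j + 1)) 1 * (cornerUnit k + cornerUnit (k + 1)) 1 = -2 by rw [h, h']; decide)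
          linarith
    have h1 : 0 < (cornerUnit j + cornerUnit (j + 1)) 1 * (cornerUnit k + cornerUnit (k + 1)) 1 := by
      rcases hprod 1 with h | h
      · rw [h]; decide
      · exfalso
        rcases hprod 0 with h' | h'
        · have : ((cornerUnit j + cornerUnit (j + 1)) 0 : ℝ) * ((cornerUnit k + cornerUnit (k + 1)) 0 : ℝ) + ((cornerUnit j + cornerUnit (j + 1)) 1 : ℝ) * ((cornerUnit k + cornerUnit (k + 1)) 1 : ℝ) = 0 := by
            exact_mod_cast (show (cornerUnit j + cornerUnit (j + 1)) 0 * (cornerUnit k + cornerUnit (k + 1)) 0 + (cornerUnit j + cornerUnit (j + 1)) 1 * (cornerUnit k + cornerUnit (k + 1)) 1 = 0 by rw [h, h']; decide)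
          linarith
        · have : ((cornerUnit j + cornerUnit (j + 1)) 0 : ℝ) * ((cornerUnit k + cornerUnit (k + 1)) 0 : ℝ) + ((cornerUnit j + cornerUnit (j + 1)) 1 : ℝ) * ((cornerUnit k + cornerUnit (k + 1)) 1 : ℝ) = -2 := by
            exact_mod_cast (show (cornerUnit j + cornerUnit (j + 1)) 0 * (cornerUnit k + cornerUnit (k + 1)) 0 + (cornerUnit j + cornerUnit (j + 1)) 1 * (cornerUnit k + cornerUnit (k + 1)) 1 = -2 by rw [h, h']; decide)
          linarith
    exact diag_eq_of_mul_pos h0 h1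
  rw [hjk] at hxX hρj
  refine ⟨hxX, ?_⟩
  rw [← hρj]
  exact ball_infDist_frontier_subset' hΩ (by rw [← hjk]; exact hxΩ)

/-- **The covering lemma (no forced site away from the cut).** Let `y` be a site of the
square-lattice boundary `zdBoundary` of discrete Dobrushin data on an open set with positive
mesh, and `X ∌ y` a finite set of boundary sites none of which is joined to `y` by an edge of
`Ω_δ`.  Then the disc `closedBall (δy) (infDist (δy) ∂Ω)` is NOT covered by the discs of `X`.
Indeed, by `add_diag_mem_of_cover` the four diagonal neighbours of `y` would carry empty open
discs of radius `δ√2`, making the four faces at `y` inner (`isInnerFace_of_corner_ball`), so that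
`y` would not be a boundary site (`not_mem_zdBoundary_of_forall_isInnerFace`).  In a labelling of
`zdBoundary` whose bichromatic `Ω_δ`-edges are the two cut edges only, this is the no-forcing
condition of `zdDiscretisationFamily_of_labelling` at every site off the cut edges. [folklore] -/
theorem not_closedBall_subset_of_forall_not_adj {E : DiscreteDobrushin} (hΩ : IsOpen E.Ω)
    (hδ : 0 < E.δ) {y : Site 2} (hy : y ∈ E.zdBoundary) {X : Set (Site 2)}
    (hX : X ⊆ E.zdBoundary) (hfin : X.Finite) (hyX : y ∉ X)
    (hadj : ∀ x ∈ X, ¬ (discreteDomainGraph E.Ω E.δ).Adj y x) :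
    ¬ closedBall (meshPoint E.δ y) (infDist (meshPoint E.δ y) (frontier E.Ω)) ⊆
      ⋃ x ∈ X, closedBall (meshPoint E.δ x) (infDist (meshPoint E.δ x) (frontier E.Ω)) := by
  intro hcov
  have hyD : y ∈ meshDomain E.Ω E.δ := E.zdBoundary_subset_meshDomain hy
  refine not_mem_zdBoundary_of_forall_isInnerFace (fun k => ?_) hy
  obtain ⟨hxk, hballk⟩ := add_diag_mem_of_cover hΩ hδ hy hX hfin hyX hcov k
    (fun x hx h => absurd h (hadj x hx))
  have hne : ∀ i, y i ≠ (y + (cornerUnit k + cornerUnit (k + 1))) i := fun i h =>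
    diag_apply_ne_zero k i (by rw [Pi.add_apply] at h; omega)
  exact isInnerFace_of_corner_ball hδ (isCorner_faceAt y k) (isCorner_add_diag_faceAt y k) hne
    hyD (E.zdBoundary_subset_meshDomain (hX hxk)) hballk
end Summit.CriticalPhenomena.CardyFormulaZ2.Theorems.DiscretisationFamilyExists

end
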